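import Literature.MathematicalPhysics.QuantumFieldTheory.Balaban1983to89.Node00.Record12BgRowCoClassGaugeRGuardedB

/-!
# K0⁷ — PART 2-G‴ OVER A **BOND-LEVEL DETERMINING DATUM** AND A **TOP-DATA PREDICATE**: stub 2′ fills the (9)-supplier slot under the grid-numerics guard `A‴(c, c₀, c₁)` for the
# step tokens over `(bd, Dat)` — `gauge9SupplierG3B_of_prop6MemberP` (k0-s1-w3's `…K0PrintCubeOfStepTokensGridGuarded.gauge9SupplierG3_of_prop6MemberP` with F0c's
# `Prop8RegSepTopStepGB … bd Dat …` as the stub-1 hypothesis and S1b-1's `Gauge9RegSepTopStepGB … bd Dat …` as the conclusion), plus the (9) `CoP` SENTENCE for minimisers on the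
# `bd`-fibre under the same guard (S1b-2's `variationalThm1GaugeRegSepCoP7MGB_of_gauge9TopStepGB`) — the (9)-half of Stage 3's `…K0AllTorusOfStepTokensGuardedZB′` in one call

Cell `pub-ymgap` (HUMAN RULINGS D-0062 ∕ D-0088 ∕ D-0145), width seat `pub-ymgap-dag-n07-w2` g7 (claim board (iii-b) rows S1b ∕ S1b-2; WORKPLAN-IIIB 27c850bec22d4efe Stage 3 names
«`gauge9SupplierG3_of_prop6MemberP′`» as the (9)-supplier the closing file re-keys to), 2026-08-30.  `--kind proof --supports stmt-QuantumFields-20541` (K0⁷; helper; count-neutral).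
PURELY ADDITIVE — «print-datum twin of `…K0PrintCubeOfStepTokensGridGuarded` §2 (FLAG №16 ∕ LOCATE-HSEAM 5d3298b8d191f169); the (b)-instance `gauge9SupplierG3_of_prop6MemberP` stays landed
and true on its own text»; nothing in the tree is modified.  Theorems only (0 `def`, 0 `sorry`).
EDITION v1.1 (2026-08-30, director-ym №354 (3) «RFloor cut»; k0-s1-w1 g9 TRAIN-K0 MANIFEST row «RFloor cut»): the import of `Thm/…K0PrintCubeOfStepTokensRFloor` (whose only use was
`max_floor_le_pow`) is DROPPED and the two floor inequalities are proved here as private lemmas (`floorP_mul_le_pow_gb`, `max_floor_le_pow_gb`), so that this module — and the V23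
closing road above it (`Thm/…K0AllTorusOfStepTokensGuardedZBLam`) — imports NOTHING of the R∕RFloor K0 road; both theorem STATEMENTS are byte-identical to v1.0 ✓p766618.
CONSUMED BY NAME: F0c `Node00/CriticalOnFibreTopGuardedB` (dag-n07-e g33: `BondDatum`, `TopData`, `Prop8RegSepTopStepGB`, `.of_le`), S1b-1 `Node00/TorusCoverGaugeTokensGuardedB` (this seat,
✓p765802: `Gauge9RegSepTopStepGB`, `gauge9GBP_of_prop8TopStepGB_of_prop6P_of_one_le`, `.of_imp`), S1b-2 `Node00/Record12BgRowCoClassGaugeRGuardedB` (this seat, ✓p766019: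
`VariationalThm1GaugeRegSepCoP7MGB`, `variationalThm1GaugeRegSepCoP7MGB_of_gauge9TopStepGB`), 36c's `a0OfP ∕ b9OfP ∕ zdCubP`
and their positivity, stub 2′'s hypothesis shape `h2P` VERBATIM (landed p595104).
[15] = [Balaban1985Variational]; [6] = [Balaban1985RegularSpaces]; [II] = [Balaban1984PropagatorsII]; [III] = [Balaban1988Convergent]; [I] = [Balaban1987RG1].

WHY.  On the K0 road of record (`…K0AllTorusOfStepTokensGuardedZB` :374–375) the (9)-token under `A‴` is SUPPLIED from stub 2′ ([6] Prop. 6 on print's cube class) and the stub-1 step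
fact by `gauge9SupplierG3_of_prop6MemberP`, which calls module 51's `gauge9GP_of_prop8TopStepG_of_prop6P_of_one_le` BY NAME.  Under the (E1)∕(iii-b) plan the stub-1 text and the
(9)-token are re-keyed to the [II] (2.3) datum — instances `bd := lamDatum F` of F0c's ∕ S1b-1's `(bd, Dat)`-parametrised tokens — so Stage 3's closing file needs the same supplier over
`(bd, Dat)`.  The composition is pointwise bookkeeping (cube letter `j := ρ₀ + 3 + c + c₀ + c₁`, refined guard `A‴(c′, c₀, c₁)`, `c′ := max c ((11·4 + 4ρ₀L)·L)`, `B₉ = b9OfP·B₃`,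
`a₁′ = min a₁ (a0OfP∕B₃)`), identical for every `(bd, Dat)` and every `N`.

CONTENTS.  ★★ `gauge9SupplierG3B_of_prop6MemberP` (k0-s1-w3's §2 over `(bd, Dat)`, any `N ≥ 1`) · ★ `gaugeCoP7MGBSupplierG3_of_prop6MemberP` (the same output read as S1b-2's (9) `CoP`
SENTENCE for minimisers on the `bd`-fibre under `A‴(c′, c₀, c₁)` — what the witness-level closer `…K0Stub1GridNumericsGuardWitness′` feeds to the row body).
NOT HERE: PART 1-G‴ ∕ the V21∕V23 compositions over `(bd, Dat)` (`exists_k0H_of_…′`, `record13SepCoPHBody_of_…′`) — they run through the S1d inhabitation modules and Stage 2's background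
(claim board rows S1d ∕ S2 ∕ S3-L3); the stub texts (V23, plan seat).
HONEST FRAMING: count-neutral kernel re-keying BY NAME; every [15]∕[6] sentence is a HYPOTHESIS (a `Prop`, never asserted, inhabited nowhere here); CONDITIONAL on texts the plan has NOT
registered (V22-Z fe2ecbb43f63b100 stands); K0⁷ stub 1 ∕ K1⁹ NOT closed; N07 NOT discharged; counts unmoved (typed 28∕28 · discharged 8∕28); the route closes only the conditional
finite-𝕋⁴ rung `BalabanLadder.UV` — the YM mass gap (Clay) is NOT proved by any of this; nothing continuum ∕ ℝ⁴ ∕ OS.  No `sorry`, `def`, `instance`, `notation`.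
-/

noncomputable section

open MeasureTheory
open scoped Matrix.Norms.L2Operator

namespace Summit.QuantumFields.YangMills.Theorems.K0PrintCubeOfStepTokensGridGuardedB

open Literature.MathematicalPhysics.QuantumFieldTheory.Balaban1983to89
open Literature.MathematicalPhysics.QuantumFieldTheory.Balaban1983to89.Node00
open Literature.MathematicalPhysics.QuantumFieldTheory.Balaban1983to89.T4Continuum
open Literature.MathematicalPhysics.QuantumFieldTheory.Balaban1983to89.FlowStep
open Literature.MathematicalPhysics.QuantumFieldTheory.Balaban1983to89.FlowStepRuns
open Literature.MathematicalPhysics.QuantumFieldTheory.Balaban1983to89.B8LeafModelZd (ZdIdx)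

/-! ## §1  PART 2-G‴ over `(bd, Dat)`: stub 2′ fills the (9)-supplier slot under `A‴` -/

section Part2GridGuardedB

variable (F : T4Family) {N : ℕ} [NeZero N]

/-- `(11·4 + 4·(ρ₀L))·L ≤ L^(ρ₀+3)` for `1 ≤ ρ₀` on the lattices of record (`L` odd, `L > 11`) — k0-s1-w3's `floorP_mul_le_pow` (PART 2's arithmetic), re-proved here so that this module
does not import the R road (v1.1). [cite: Balaban1985RegularSpaces, (1.130) p.99, p.98 (bookkeeping); Balaban1987RG1, (0.1) p.251 («L odd > 11»)] -/
private theorem floorP_mul_le_pow_gb {ρ₀ : ℕ} (hρ₀ : 1 ≤ ρ₀) : (11 * 4 + 4 * (ρ₀ * F.L)) * F.L ≤ F.L ^ (ρ₀ + 3) := by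
  have hL : 13 ≤ F.L := by obtain ⟨hodd, _⟩ := F.hL; have := F.hL11; rcases hodd with ⟨r, hr⟩; omega
  have hρ : ρ₀ ≤ F.L ^ ρ₀ := (Nat.lt_pow_self (by omega)).le
  have h1 : 44 + 4 * (ρ₀ * F.L) ≤ F.L * F.L * F.L ^ ρ₀ := by
    have h2 : 44 + 4 * (ρ₀ * F.L) ≤ 13 * F.L * ρ₀ := by nlinarith
    have h3 : 13 * F.L * ρ₀ ≤ F.L * F.L * ρ₀ := Nat.mul_le_mul_right _ (Nat.mul_le_mul_right _ hL)
    exact h2.trans (h3.trans (Nat.mul_le_mul_left _ hρ))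
  calc (11 * 4 + 4 * (ρ₀ * F.L)) * F.L = (44 + 4 * (ρ₀ * F.L)) * F.L := by ring
    _ ≤ (F.L * F.L * F.L ^ ρ₀) * F.L := Nat.mul_le_mul_right _ h1
    _ = F.L ^ (ρ₀ + 3) := by ring

/-- THE TWO FLOORS FIT UNDER THE CUBE LETTER CHOSEN BELOW: `max c ((11·4 + 4·(ρ₀·L))·L) ≤ L^(ρ₀+3+c+c₀+c₁)` for `1 ≤ ρ₀` (k0-s1-w3's `max_floor_le_pow` composed with the monotonicity of
`L^·`, re-proved here; v1.1). [cite: Balaban1985RegularSpaces, (1.130) p.99, p.98 (bookkeeping); Balaban1985Variational, (144) p.300, p.304 lines 1–2] -/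
private theorem max_floor_le_pow_gb {ρ₀ : ℕ} (hρ₀ : 1 ≤ ρ₀) (c c₀ c₁ : ℕ) : max c ((11 * 4 + 4 * (ρ₀ * F.L)) * F.L) ≤ F.L ^ (ρ₀ + 3 + c + c₀ + c₁) := by
  have hL1 : 1 < F.L := F.hL.2
  have hL0 : 0 < F.L := by omega
  refine max_le ?_ ?_
  · exact (Nat.lt_pow_self hL1).le.trans (Nat.pow_le_pow_right hL0 (by omega))
  · exact (floorP_mul_le_pow_gb F hρ₀).trans (Nat.pow_le_pow_right hL0 (by omega))

/-- **★★ STUB 2′ AT `F` FILLS THE (9)-SUPPLIER SLOT UNDER `A‴` FOR THE STEP TOKENS OVER `(bd, Dat)`** — k0-s1-w3's `gauge9SupplierG3_of_prop6MemberP` with F0c's `Prop8RegSepTopStepGB … bd Dat`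
as the stub-1 hypothesis and S1b-1's `Gauge9RegSepTopStepGB … bd Dat` as the conclusion: S1b-1's `gauge9GBP_of_prop8TopStepGB_of_prop6P_of_one_le` BY NAME at `M := L^j`,
`j := ρ₀ + 3 + c + c₀ + c₁` (so `c ≤ c′ ≤ L^j`, `c₀ ≤ j + 1`, `c₁ ≤ j`), its output guard `A‴ ⊓ floor c(ρ₀)` refined to `A‴(c′, c₀, c₁)`, `c′ := max c ((11·4 + 4ρ₀L)·L)`, by `.of_imp`;
`B₉ = b9OfP·B₃`, ceiling `a₁′ = min a₁ (a0OfP∕B₃)`.  Any `N ≥ 1`, any bond-datum family `bd`, any top-data predicate `Dat`.  Print-datum twin of `gauge9SupplierG3_of_prop6MemberP` (FLAG №16 ∕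
LOCATE-HSEAM 5d3298b8d191f169); the (b)-instance stays landed and true on its own text.  CONDITIONAL.
[cite: Balaban1985Variational, Thm 1 (8)–(10) p.279, (144)–(152) pp.300–301, Prop. 8 p.304, p.304 lines 1–2; Balaban1985RegularSpaces, Prop. 6 p.99, p.98; Balaban1984PropagatorsII, (2.3) p.224; Balaban1988Convergent, (2.1) p.254, (2.5) p.255; Balaban1987RG1, (0.1) p.251] -/
theorem gauge9SupplierG3B_of_prop6MemberP
    (h2P : ∃ (ρ₀ : ℕ) (B₁ cP : ℝ), 1 ≤ ρ₀ ∧ 0 ≤ B₁ ∧ 0 < cP ∧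
      (letI : CStarAlgebra (MatA N) := {}; B8.Prop6Printed 4 (F.L : ℝ) B₁ cP (fun i : ZdIdx 4 F.L => zdCubP (MatA N) F.L ρ₀ i)))
    (bd : BondDatum F) (Dat : TopData F N) (c c₀ c₁ : ℕ) (B₃ a₀ a₁ : ℝ) (hB₃ : 2 * (F.L : ℝ) ^ 2 ≤ B₃) (_ha₀ : 0 < a₀) (ha₁ : 0 < a₁)
    (h8 : Prop8RegSepTopStepGB F N (fun ν K Ω => suppDomOfRecord F ν K Ω) (fun ν M g K k _s => c ≤ ν.M₁ ∧ k + c₀ ≤ F.m + K ∧ F.L ^ c₁ ∣ M ∧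
      ∀ i, 1 ≤ i → i ≤ k → dCubeSide (F.P K).L M (RkOfRecord (F.P K).L ν.r (g i)) i ∣ (F.P K).sitesPerDir 0) bd Dat B₃ a₀ a₁) :
    ∃ (j c' : ℕ) (B₉ a₁' : ℝ), c ≤ c' ∧ c' ≤ F.L ^ j ∧ c₀ ≤ j + 1 ∧ c₁ ≤ j ∧ 0 < B₉ ∧ 0 < a₁' ∧ a₁' ≤ a₁ ∧
      Gauge9RegSepTopStepGB F N (fun ν K Ω => suppDomOfRecord F ν K Ω) (F.L ^ j) (fun ν M g K k _s => c' ≤ ν.M₁ ∧ k + c₀ ≤ F.m + K ∧ F.L ^ c₁ ∣ M ∧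
      ∀ i, 1 ≤ i → i ≤ k → dCubeSide (F.P K).L M (RkOfRecord (F.P K).L ν.r (g i)) i ∣ (F.P K).sitesPerDir 0) bd Dat B₃ B₉ a₀ a₁' := by
  obtain ⟨ρ₀, B₁, cP, hρ₀, hB₁, hcP, hP6⟩ := h2P
  have hL : (0 : ℝ) < (F.L : ℝ) := by exact_mod_cast lt_trans Nat.zero_lt_one F.hL.2
  have hBpos : (0 : ℝ) < B₃ := lt_of_lt_of_le (mul_pos two_pos (pow_pos hL 2)) hB₃
  set M : ℕ := F.L ^ (ρ₀ + 3 + c + c₀ + c₁) with hM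
  have ha0P : 0 < a0OfP F N M (ρ₀ * F.L) B₁ cP := a0OfP_pos (F := F) (N := N) M (ρ₀ * F.L) hB₁ hcP
  have ha₁' : 0 < min a₁ (a0OfP F N M (ρ₀ * F.L) B₁ cP / B₃) := lt_min ha₁ (div_pos ha0P hBpos)
  have hle : B₃ * min a₁ (a0OfP F N M (ρ₀ * F.L) B₁ cP / B₃) ≤ a0OfP F N M (ρ₀ * F.L) B₁ cP :=
    calc B₃ * min a₁ (a0OfP F N M (ρ₀ * F.L) B₁ cP / B₃) ≤ B₃ * (a0OfP F N M (ρ₀ * F.L) B₁ cP / B₃) :=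
          mul_le_mul_of_nonneg_left (min_le_right _ _) hBpos.le
      _ = a0OfP F N M (ρ₀ * F.L) B₁ cP := mul_div_cancel₀ _ hBpos.ne'
  have hfloor : max c ((11 * 4 + 4 * (ρ₀ * F.L)) * F.L) ≤ F.L ^ (ρ₀ + 3 + c + c₀ + c₁) := max_floor_le_pow_gb F hρ₀ c c₀ c₁
  exact ⟨ρ₀ + 3 + c + c₀ + c₁, max c ((11 * 4 + 4 * (ρ₀ * F.L)) * F.L), b9OfP F M (ρ₀ * F.L) B₁ * B₃, min a₁ (a0OfP F N M (ρ₀ * F.L) B₁ cP / B₃),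
    le_max_left _ _, hfloor, by omega, by omega, mul_pos (b9OfP_pos (F := F) M (ρ₀ * F.L) hB₁) hBpos, ha₁', min_le_left _ _,
    (gauge9GBP_of_prop8TopStepGB_of_prop6P_of_one_le (h8.of_le le_rfl (min_le_left _ _)) hB₁ hcP hρ₀ hP6 M hBpos hle).of_imp
      fun _ _ _ _ _ _ h => ⟨⟨(le_max_left _ _).trans h.1, h.2⟩, (le_max_right _ _).trans h.1⟩⟩

/-- **★ THE SAME SUPPLIER READ AS THE (9) `CoP` SENTENCE FOR MINIMISERS ON THE `bd`-FIBRE UNDER `A‴(c′, c₀, c₁)`** (S1b-2's `variationalThm1GaugeRegSepCoP7MGB_of_gauge9TopStepGB` on §1's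
token): what the witness-level closer of the ᴮ road feeds to the row body together with the (8)-sentence.  CONDITIONAL.
[cite: Balaban1985Variational, Thm 1 (8)–(9) p.279, (144)–(152) pp.300–301, Prop. 8 p.304, p.304 lines 1–2; Balaban1985RegularSpaces, Prop. 6 p.99; Balaban1984PropagatorsII, (2.3) p.224; Balaban1987RG1, (0.1) p.251] -/
theorem gaugeCoP7MGBSupplierG3_of_prop6MemberP
    (h2P : ∃ (ρ₀ : ℕ) (B₁ cP : ℝ), 1 ≤ ρ₀ ∧ 0 ≤ B₁ ∧ 0 < cP ∧
      (letI : CStarAlgebra (MatA N) := {}; B8.Prop6Printed 4 (F.L : ℝ) B₁ cP (fun i : ZdIdx 4 F.L => zdCubP (MatA N) F.L ρ₀ i)))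
    (bd : BondDatum F) (Dat : TopData F N) (c c₀ c₁ : ℕ) (B₃ a₀ a₁ : ℝ) (hB₃ : 2 * (F.L : ℝ) ^ 2 ≤ B₃) (ha₀ : 0 < a₀) (ha₁ : 0 < a₁)
    (h8 : Prop8RegSepTopStepGB F N (fun ν K Ω => suppDomOfRecord F ν K Ω) (fun ν M g K k _s => c ≤ ν.M₁ ∧ k + c₀ ≤ F.m + K ∧ F.L ^ c₁ ∣ M ∧
      ∀ i, 1 ≤ i → i ≤ k → dCubeSide (F.P K).L M (RkOfRecord (F.P K).L ν.r (g i)) i ∣ (F.P K).sitesPerDir 0) bd Dat B₃ a₀ a₁) :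
    ∃ (j c' : ℕ) (B₉ a₁' : ℝ), c ≤ c' ∧ c' ≤ F.L ^ j ∧ c₀ ≤ j + 1 ∧ c₁ ≤ j ∧ 0 < B₉ ∧ 0 < a₁' ∧ a₁' ≤ a₁ ∧
      VariationalThm1GaugeRegSepCoP7MGB F N (F.L ^ j) (fun ν M g K k _s => c' ≤ ν.M₁ ∧ k + c₀ ≤ F.m + K ∧ F.L ^ c₁ ∣ M ∧
      ∀ i, 1 ≤ i → i ≤ k → dCubeSide (F.P K).L M (RkOfRecord (F.P K).L ν.r (g i)) i ∣ (F.P K).sitesPerDir 0) bd Dat B₃ B₉ a₀ a₁' := by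
  obtain ⟨j, c', B₉, a₁', hc, hc', hc₀, hc₁, hB₉, ha₁', ha₁'le, h9⟩ := gauge9SupplierG3B_of_prop6MemberP F h2P bd Dat c c₀ c₁ B₃ a₀ a₁ hB₃ ha₀ ha₁ h8
  exact ⟨j, c', B₉, a₁', hc, hc', hc₀, hc₁, hB₉, ha₁', ha₁'le, variationalThm1GaugeRegSepCoP7MGB_of_gauge9TopStepGB h9⟩

end Part2GridGuardedB

end Summit.QuantumFields.YangMills.Theorems.K0PrintCubeOfStepTokensGridGuardedB

end
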